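import Mathlib
import Literature.NumberTheory.Automorphic.CuspidalSubspace
import Literature.NumberTheory.Automorphic.AutomorphicKernelOperatorsCommute

/-!
# The invariant integral operators are compact on the cuspidal subspace
(Iwaniec, *Spectral Methods of Automorphic Forms*, GSM 53, §4.2: the Proposition on p. 49,
Lemma 4.2, Proposition 4.3, Corollary 4.4, Proposition 4.5; §4.3, the Hilbert–Schmidt step of
Theorem 4.7; PDF pp. 48–52)

Layer 21 of the `provefact` decomposition of `Literature.NumberTheory.Automorphic.sl2BallCount_asymp`
(`HyperbolicLatticeCount.lean`), fourth brick of the *discrete part* of the spectral theorem for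
`L²(SL₂(ℤ)\ℍ)` behind the remaining named fact `Iwaniec2002_thm_7_4_modular`
(`ModularPretrace.lean`). Theorem 4.7 ("`Δ` has pure point spectrum in `𝓒(Γ\ℍ)`") rests on the
compactness of an invariant integral operator on the space of cusp forms: Iwaniec subtracts from
the automorphic kernel `K(z, w)` its principal part `H(z, w)` ((4.5)), which annihilates cusp forms
(Proposition 4.3, Corollary 4.4: `L = L̂` on `𝓒(Γ\ℍ)`), and shows by the Euler–MacLaurin formula
that `K̂ = K - H` is bounded on `F × F` (Proposition 4.5), so that `L̂` is of Hilbert–Schmidt type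
and the Hilbert–Schmidt theorem applies (§4.3, p. 51). This file proves the conclusion — **for
`Γ = SL₂(ℤ)` and every Lipschitz test kernel `k`, the operator `T_k` of
`AutomorphicKernelOperators.lean` restricted to the cuspidal subspace `𝓒 ⊆ L²(𝒟)` of
`CuspidalSubspace.lean` is a compact self-adjoint operator, and these operators commute** — by the
same cancellation organised slightly differently (no principal part is introduced; Mathlib has no
Hilbert–Schmidt operators): everything here is proved, nothing is vendored.

1. Oscillation of a Lipschitz point-pair kernel: `|k(u(z,w)) - k(u(z',w))| ≤ L (sinh(R+1)/2) ρ(z,z')`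
   on `B(z, R+1)` and `0` outside, `R = 2 arsinh √M` the radius of the support (`2u + 1 = cosh ρ`);
   hence **`‖L_k G(z) - L_k G(z')‖ ≤ C_k ρ(z, z') ∫_{B(z,R+1)} |G| dμ`** for `G ∈ L¹_loc(ℍ)`,
   `ρ(z, z') ≤ 1` (`norm_invariantOperator_sub_le`), and continuity of `L_k G`.
2. The mass of an automorphic extension `g^Γ` (`autExt`, `g ∈ L²(𝒟)`) high in the cusp: a set of
   points of height `≥ 1` with real parts in `[n, n+1]` lies in `(𝒟 - n) ∪ (𝒟 - n - 1)`, so it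
   carries at most `2‖g‖²` (`lintegral_sq_autExt_strip_le`); a ball `B(z, r)` with `Im z ≥ e^r`
   meets `≤ 2⌈Im z (e^r - 1)⌉ + 2` such strips (`|Re w - Re z| ≤ Im z (e^{ρ} - 1)`, Mathlib's
   `UpperHalfPlane.dist_coe_le`), whence **`∫_{B(z,r)} |g^Γ|² ≤ (4 Im z (e^r - 1) + 8) ‖g‖²`**
   (`lintegral_sq_autExt_closedBall_le`; this is the role of Lemma 2.10 / (4.6), the linear
   growth in `Im z` of orbit counts in the cusp).
3. **Cusp decay** (`norm_kernelOp_le_of_cuspidal`; Proposition 4.3 + Corollary 4.4 +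
   Proposition 4.5 in one estimate): for `g ∈ 𝓒` the cusp mean of `T_k g = L_k g^Γ` vanishes
   identically (`(L_k G)₀ = L_k(G₀)`, `CuspidalSubspace.lean`), so
   `T_k g(z) = ∫_0^1 (T_k g(z) - T_k g(z + ξ)) dξ` is bounded by the oscillation of `L_k g^Γ` along a
   horocycle piece of hyperbolic length `1/Im z`; by 1–2 this gives
   **`|T_k g(z)| ≤ C_k (Im z)^{-1/2} ‖g‖` for `Im z ≥ e^{R+1}`**.
4. The truncated domain `𝒟_Y = {z ∈ 𝒟 : Im z ≤ Y}` ((2.3)) is compact, and on it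
   `∫_{B(z,R+1)} |g^Γ| ≤ A_Y ‖g‖` uniformly (the local `L²` bound of `autExt`,
   `AutomorphicKernelOperators.lean`), so `{T_k g : ‖g‖ ≤ 1}` is uniformly bounded and uniformly
   equicontinuous on `𝒟_Y`.
5. **Compactness** (`isCompactOperator_kernelCLM_comp_cuspSubtype`): the image of the unit ball of
   `𝓒` under `T_k` is totally bounded in `L²(𝒟)` — choose `Y` with `C_k Y^{-1/2}` small, a finite
   `δ`-net of `𝒟_Y`, and a finite net of the (bounded, finite-dimensional) vectors of
   point evaluations at the net points; two cusp forms with close evaluations have `T_k`-images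
   uniformly close on `𝒟` (3–4), hence close in `L²(𝒟)` (`|𝒟| = π/3 < ∞`).
6. The Hilbert space `𝓒` (closed in `L²(𝒟)`, hence complete) and **`cuspKernelCLM`**, the
   restriction `T_k|_𝓒 : 𝓒 →L[ℂ] 𝓒` (invariance from `CuspidalSubspace.lean`): compact for
   Lipschitz test kernels (`isCompactOperator_cuspKernelCLM`), symmetric/self-adjoint
   (`isSelfAdjoint_cuspKernelCLM`, from `AutomorphicKernelOperators.lean`) and pairwise commuting
   (`commute_cuspKernelCLM`, from `AutomorphicKernelOperatorsCommute.lean`) — the input of the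
   spectral theorem for compact self-adjoint operators (Mathlib's
   `LinearMap.IsSymmetric`/`IsCompactOperator` theory, `Analysis.InnerProductSpace.Spectrum`) in the
   next layer (Theorem 4.7). The tent kernels `max(0, 1 - |u|/δ)` show the hypotheses are met
   (`isCompactOperator_cuspKernelCLM_tentKernel`).

What is *not* here: compactness for merely continuous (non-Lipschitz) test kernels (it follows by
norm approximation, `isCompactOperator_of_tendsto`, but is not needed: the next layers diagonalise
the family indexed by Lipschitz kernels and extend eigen-relations to all test kernels at the level
of functions); the principal part `H(z, w)` and the bounded kernel `K̂` themselves.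

Mathlib: `IsCompactOperator` with `isCompactOperator_iff_isCompact_closure_image_closedBall`,
`IsCompactOperator.codRestrict`, `isCompact_iff_totallyBounded_isComplete`,
`TotallyBounded.exists_subset`, `finite_cover_balls_of_compact`, `Lp.norm_le_of_ae_bound`,
`UpperHalfPlane.dist_coe_le` / `im_div_exp_dist_le` / `dist_le_dist_coe_div_sqrt`,
`IsometryEquiv.constSMul` + `measure_smul` (balls have centre-independent measure),
`LinearMap.IsSymmetric.isSelfAdjoint`, `Convex.norm_image_sub_le_of_norm_deriv_le` (`cosh` is
`sinh A`-Lipschitz on `[0, A]`). Literature: `kernelOp`, `kernelCLM`, `autExt`,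
`lintegral_enorm_sq_autExt_le`, `kernelOp_eq_invariantOperator`, `kernelCLM_isSymmetric`
(`AutomorphicKernelOperators.lean`); `kernelCLM_comp_comm` (`AutomorphicKernelOperatorsCommute.lean`);
`cuspMean`, `cuspSubmodule`, `isClosed_cuspSubmodule`, `cuspMean_invariantOperator`,
`kernelCLM_mem_cuspSubmodule`, `dist_vadd_self_le`, `lintegral_enorm_le_sqrt_mul`
(`CuspidalSubspace.lean`); `norm_invariantOperator_le`, `integrable_kernel_mul`
(`InvariantIntegralOperators.lean`); `dist_le_of_pointPairInv_le` (`AutomorphicKernel.lean`).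
Neither Mathlib nor Literature had a compactness result for integral operators on `L²` of a
fundamental domain (`lean search 'IsCompactOperator.*kernel|Hilbert.Schmidt|cusp.*compact'`: none).

## References
* [Iwaniec2002] H. Iwaniec, *Spectral Methods of Automorphic Forms*, 2nd ed., GSM 53, AMS 2002,
  §4.2–§4.3 (Lemma 4.2, Prop. 4.3, Cor. 4.4, Prop. 4.5, Thm 4.7), PDF pp. 48–52; §2.2 & Lemma 2.10,
  PDF pp. 28–29, 37; §1.8, PDF pp. 20–21; (1.3)–(1.4), PDF p. 9; (2.3), PDF p. 30; §7.2, PDF p. 73.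
-/

noncomputable section

open MeasureTheory Set Filter Real UpperHalfPlane
open scoped Topology MatrixGroups ComplexConjugate NNReal ENNReal Modular Pointwise

namespace Literature.NumberTheory.Automorphic

/-! ## 1. Lipschitz kernels: the oscillation of `k(u(z, w))` in `z` -/

section Oscillation

variable {k : ℝ → ℝ} {L : ℝ≥0} {M : ℝ}

/-- The radius of the hyperbolic ball `{w : u(z, w) ≤ M}`: `R_M = 2 arsinh √M`. [folklore] -/
def kernelRadius (M : ℝ) : ℝ := 2 * Real.arsinh (Real.sqrt M)

/-- `R_M ≥ 0`. [folklore] -/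
theorem kernelRadius_nonneg (M : ℝ) : 0 ≤ kernelRadius M := by
  unfold kernelRadius
  have : 0 ≤ Real.arsinh (Real.sqrt M) := Real.arsinh_nonneg_iff.mpr (Real.sqrt_nonneg _)
  linarith

/-- `cosh` is `sinh A`-Lipschitz on `[0, A]`. [folklore] -/
theorem abs_cosh_sub_cosh_le {A a b : ℝ} (ha : a ∈ Icc 0 A) (hb : b ∈ Icc 0 A) :
    |Real.cosh a - Real.cosh b| ≤ Real.sinh A * |a - b| := by
  have h := Convex.norm_image_sub_le_of_norm_deriv_le (f := Real.cosh) (s := Icc 0 A) (C := Real.sinh A)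
    (fun x _ => Real.differentiable_cosh x) ?_ (convex_Icc 0 A) hb ha
  · simpa [Real.norm_eq_abs] using h
  · intro x hx
    rw [Real.deriv_cosh, Real.norm_eq_abs, abs_of_nonneg (Real.sinh_nonneg_iff.mpr hx.1)]
    exact Real.sinh_le_sinh.mpr hx.2

/-- `|u(z, w) - u(z', w)| ≤ (sinh A / 2) ρ(z, z')` when `ρ(z, w), ρ(z', w) ≤ A`
(`2u + 1 = cosh ρ`). [cite: Iwaniec2002, (1.3)–(1.4), PDF p. 9] -/
theorem abs_pointPairInv_sub_le {A : ℝ} {z z' w : ℍ} (hz : dist z w ≤ A) (hz' : dist z' w ≤ A) :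
    |pointPairInv z w - pointPairInv z' w| ≤ Real.sinh A / 2 * dist z z' := by
  have h1 := cosh_dist_eq_one_add_two_mul_pointPairInv z w
  have h2 := cosh_dist_eq_one_add_two_mul_pointPairInv z' w
  have e : pointPairInv z w - pointPairInv z' w = (Real.cosh (dist z w) - Real.cosh (dist z' w)) / 2 := by
    linarith
  rw [e, abs_div, abs_two]
  have h3 := abs_cosh_sub_cosh_le (A := A) ⟨dist_nonneg, hz⟩ ⟨dist_nonneg, hz'⟩
  have h4 : |dist z w - dist z' w| ≤ dist z z' := abs_dist_sub_le z z' w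
  have hA : 0 ≤ Real.sinh A := Real.sinh_nonneg_iff.mpr (dist_nonneg.trans hz)
  calc |Real.cosh (dist z w) - Real.cosh (dist z' w)| / 2 ≤ Real.sinh A * |dist z w - dist z' w| / 2 := by
        gcongr
    _ ≤ Real.sinh A * dist z z' / 2 := by gcongr
    _ = Real.sinh A / 2 * dist z z' := by ring

/-- **Oscillation of a Lipschitz point-pair kernel**: for `k` `L`-Lipschitz and vanishing on
`[M, ∞)`, and `ρ(z, z') ≤ 1`,
`|k(u(z, w)) - k(u(z', w))| ≤ L (sinh(R_M + 1)/2) ρ(z, z') · 𝟙[ρ(z, w) ≤ R_M + 1]`.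
[cite: Iwaniec2002, §4.2, PDF pp. 49–51] -/
theorem abs_kernel_sub_kernel_le (hL : LipschitzWith L k) (hM : ∀ u, M ≤ u → k u = 0)
    {z z' : ℍ} (hzz' : dist z z' ≤ 1) (w : ℍ) :
    |k (pointPairInv z w) - k (pointPairInv z' w)| ≤
      (L : ℝ) * (Real.sinh (kernelRadius M + 1) / 2) * dist z z' *
        (Metric.closedBall z (kernelRadius M + 1)).indicator (fun _ => (1 : ℝ)) w := by
  set R := kernelRadius M with hR
  by_cases hfar : M < pointPairInv z w ∧ M < pointPairInv z' w
  · rw [hM _ hfar.1.le, hM _ hfar.2.le, sub_self, abs_zero]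
    have : 0 ≤ (Metric.closedBall z (R + 1)).indicator (fun _ => (1 : ℝ)) w :=
      Set.indicator_nonneg (fun _ _ => zero_le_one) w
    have : 0 ≤ Real.sinh (R + 1) := Real.sinh_nonneg_iff.mpr (by linarith [kernelRadius_nonneg M])
    positivity
  · -- one of the two points is within `R` of `w`, so both are within `R + 1`
    have hnear : dist z w ≤ R + 1 ∧ dist z' w ≤ R + 1 := by
      rw [not_and_or, not_lt, not_lt] at hfar
      rcases hfar with h | h
      · have h1 : dist z w ≤ R := dist_le_of_pointPairInv_le h
        refine ⟨by linarith, ?_⟩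
        calc dist z' w ≤ dist z' z + dist z w := dist_triangle _ _ _
          _ ≤ 1 + R := by rw [dist_comm z' z]; exact add_le_add hzz' h1
          _ = R + 1 := by ring
      · have h1 : dist z' w ≤ R := dist_le_of_pointPairInv_le h
        refine ⟨?_, by linarith⟩
        calc dist z w ≤ dist z z' + dist z' w := dist_triangle _ _ _
          _ ≤ 1 + R := add_le_add hzz' h1
          _ = R + 1 := by ring
    have hmem : w ∈ Metric.closedBall z (R + 1) := by
      rw [Metric.mem_closedBall, dist_comm]; exact hnear.1
    rw [Set.indicator_of_mem hmem, mul_one]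
    calc |k (pointPairInv z w) - k (pointPairInv z' w)|
        ≤ (L : ℝ) * |pointPairInv z w - pointPairInv z' w| := by
          have := hL.dist_le_mul (pointPairInv z w) (pointPairInv z' w)
          rwa [Real.dist_eq, Real.dist_eq] at this
      _ ≤ (L : ℝ) * (Real.sinh (R + 1) / 2 * dist z z') := by
          gcongr
          exact abs_pointPairInv_sub_le hnear.1 hnear.2
      _ = (L : ℝ) * (Real.sinh (R + 1) / 2) * dist z z' := by ring

end Oscillation

/-! ## 2. Oscillation and size of `L_k G` -/

section OperatorBounds

variable {k : ℝ → ℝ} {L : ℝ≥0} {M : ℝ}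

/-- The oscillation constant `L sinh(R_M + 1)/2` of a Lipschitz kernel. [folklore] -/
def oscConst (L : ℝ≥0) (M : ℝ) : ℝ := (L : ℝ) * (Real.sinh (kernelRadius M + 1) / 2)

/-- `oscConst L M ≥ 0`. [folklore] -/
theorem oscConst_nonneg (L : ℝ≥0) (M : ℝ) : 0 ≤ oscConst L M := by
  unfold oscConst
  have : 0 ≤ Real.sinh (kernelRadius M + 1) :=
    Real.sinh_nonneg_iff.mpr (by linarith [kernelRadius_nonneg M])
  positivity

/-- **Oscillation of `L_k G`** for a Lipschitz test kernel: for `ρ(z, z') ≤ 1` and `G ∈ L¹_loc(ℍ)`,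
`‖L_k G(z) - L_k G(z')‖ ≤ L (sinh(R_M+1)/2) ρ(z, z') ∫_{B(z, R_M+1)} ‖G‖ dμ`.
[cite: Iwaniec2002, §4.2, PDF pp. 49–51] -/
theorem norm_invariantOperator_sub_le (hk : IsTestKernel k) (hL : LipschitzWith L k)
    (hM : ∀ u, M ≤ u → k u = 0) {G : ℍ → ℂ} (hG : LocallyIntegrable G) {z z' : ℍ}
    (hzz' : dist z z' ≤ 1) :
    ‖invariantOperator k G z - invariantOperator k G z'‖ ≤
      oscConst L M * dist z z' * ∫ w in Metric.closedBall z (kernelRadius M + 1), ‖G w‖ := by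
  set R := kernelRadius M with hR
  set B := Metric.closedBall z (R + 1) with hB
  have hi := integrable_kernel_mul hk hG z
  have hi' := integrable_kernel_mul hk hG z'
  have hGB : IntegrableOn (fun w => ‖G w‖) B := (hG.integrableOn_isCompact (isCompact_closedBall _ _)).norm
  rw [invariantOperator_apply, invariantOperator_apply, ← integral_sub hi hi']
  have hpt : ∀ w, ‖(k (pointPairInv z w) : ℂ) * G w - (k (pointPairInv z' w) : ℂ) * G w‖ ≤
      oscConst L M * dist z z' * B.indicator (fun w => ‖G w‖) w := by
    intro w
    rw [← sub_mul, norm_mul, ← Complex.ofReal_sub, Complex.norm_real, Real.norm_eq_abs]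
    have h := abs_kernel_sub_kernel_le hL hM hzz' w
    by_cases hw : w ∈ B
    · rw [indicator_of_mem hw] at h ⊢
      rw [mul_one] at h
      calc |k (pointPairInv z w) - k (pointPairInv z' w)| * ‖G w‖
          ≤ (L : ℝ) * (Real.sinh (R + 1) / 2) * dist z z' * ‖G w‖ :=
            mul_le_mul_of_nonneg_right h (norm_nonneg _)
        _ = oscConst L M * dist z z' * ‖G w‖ := by rw [oscConst]
    · rw [indicator_of_notMem hw] at h ⊢
      rw [mul_zero] at h ⊢
      have h0 : |k (pointPairInv z w) - k (pointPairInv z' w)| = 0 := le_antisymm h (abs_nonneg _)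
      rw [h0, zero_mul]
  calc ‖∫ w, (k (pointPairInv z w) : ℂ) * G w - (k (pointPairInv z' w) : ℂ) * G w‖
      ≤ ∫ w, ‖(k (pointPairInv z w) : ℂ) * G w - (k (pointPairInv z' w) : ℂ) * G w‖ :=
        norm_integral_le_integral_norm _
    _ ≤ ∫ w, oscConst L M * dist z z' * B.indicator (fun w => ‖G w‖) w := by
        refine integral_mono (hi.sub hi').norm ?_ hpt
        exact ((hGB.integrable_indicator measurableSet_closedBall).const_mul _)
    _ = oscConst L M * dist z z' * ∫ w in B, ‖G w‖ := by
        rw [integral_const_mul, integral_indicator measurableSet_closedBall]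

/-- The crude size bound `‖L_k G(z)‖ ≤ B_k ∫_{B(z, R_M)} ‖G‖ dμ` for `|k| ≤ B_k`, restated with
`kernelRadius`. [folklore] -/
theorem norm_invariantOperator_le' {Bk : ℝ} (hB : ∀ u, |k u| ≤ Bk) (hM : ∀ u, M ≤ u → k u = 0)
    {G : ℍ → ℂ} (hG : LocallyIntegrable G) (z : ℍ) :
    ‖invariantOperator k G z‖ ≤ Bk * ∫ w in Metric.closedBall z (kernelRadius M), ‖G w‖ :=
  norm_invariantOperator_le hB hM hG z

/-- **Cauchy–Schwarz on a set of finite measure**: `∫_S ‖G‖ ≤ √μ(S) · √(∫_S ‖G‖²)` (the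
right side read through `toReal`; both factors are finite in the applications). [folklore] -/
theorem integral_norm_le_sqrt_mul_sqrt {S : Set ℍ} (hS : volume S ≠ ∞)
    {G : ℍ → ℂ} (hGm : AEStronglyMeasurable G volume)
    (hG2 : ∫⁻ w in S, ‖G w‖ₑ ^ 2 ≠ ∞) :
    ∫ w in S, ‖G w‖ ≤ Real.sqrt ((volume S).toReal) * Real.sqrt ((∫⁻ w in S, ‖G w‖ₑ ^ 2).toReal) := by
  have h := lintegral_enorm_le_sqrt_mul (S := S) hGm
  have hfin1 : (volume S) ^ (1 / 2 : ℝ) ≠ ∞ := ENNReal.rpow_ne_top_of_nonneg (by norm_num) hS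
  have hfin2 : (∫⁻ w in S, ‖G w‖ₑ ^ 2) ^ (1 / 2 : ℝ) ≠ ∞ :=
    ENNReal.rpow_ne_top_of_nonneg (by norm_num) hG2
  rw [integral_norm_eq_lintegral_enorm hGm.restrict, Real.sqrt_eq_rpow, Real.sqrt_eq_rpow,
    ENNReal.toReal_rpow, ENNReal.toReal_rpow, ← ENNReal.toReal_mul]
  exact ENNReal.toReal_mono (ENNReal.mul_ne_top hfin1 hfin2) h

end OperatorBounds

/-! ## 3. The mass of an automorphic extension high in the cusp of `SL₂(ℤ)` -/

section CuspMass

local notation "Γℤ" => (𝒮ℒ : Subgroup (GL (Fin 2) ℝ))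

/-- `T^m ∈ SL₂(ℤ)` acts through `GL₂(ℝ)` by `w ↦ w + m`. [cite: Iwaniec2002, (3.1), PDF p. 40] -/
theorem mapGL_T_zpow_smul (m : ℤ) (w : ℍ) :
    (Matrix.SpecialLinearGroup.mapGL ℝ (ModularGroup.T ^ m) : GL (Fin 2) ℝ) • w = (m : ℝ) +ᵥ w := by
  have e : (Matrix.SpecialLinearGroup.mapGL ℝ (ModularGroup.T ^ m) : GL (Fin 2) ℝ) • w =
      (ModularGroup.T ^ m) • w := rfl
  rw [e, modular_T_zpow_smul]

/-- `T^m` lies in the modular group `𝒮ℒ ≤ GL₂(ℝ)`. [folklore] -/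
theorem mapGL_T_zpow_mem (m : ℤ) :
    (Matrix.SpecialLinearGroup.mapGL ℝ (ModularGroup.T ^ m) : GL (Fin 2) ℝ) ∈ Γℤ :=
  ⟨ModularGroup.T ^ m, rfl⟩

/-- The automorphic extension is `1`-periodic: `g^Γ(w + m) = g^Γ(w)` for `m ∈ ℤ`.
[cite: Iwaniec2002, (3.1), PDF p. 40] -/
theorem autExt_int_vadd (g : ℍ → ℂ) (m : ℤ) (w : ℍ) :
    autExt Γℤ 𝒟 g ((m : ℝ) +ᵥ w) = autExt Γℤ 𝒟 g w := by
  rw [← mapGL_T_zpow_smul, autExt_smul (mapGL_T_zpow_mem m)]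

/-- Points with `Im w ≥ 1` and `|Re w| ≤ 1/2` lie in the standard fundamental domain `𝒟`. [folklore] -/
theorem mem_fd_of_one_le_im {w : ℍ} (him : 1 ≤ w.im) (hre : |w.re| ≤ 1 / 2) : w ∈ 𝒟 := by
  refine ⟨?_, hre⟩
  rw [Complex.normSq_apply]
  have h1 : 1 ≤ w.im * w.im := by nlinarith
  have h2 : 0 ≤ (w : ℂ).re * (w : ℂ).re := mul_self_nonneg _
  rw [UpperHalfPlane.coe_im]
  linarith

/-- **One translate into `𝒟`**: if `A + m ⊆ 𝒟` for an integer `m`, then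
`∫_A |g^Γ|² ≤ ∫_𝒟 |g|²` (periodicity of `g^Γ`, invariance of `μ`, `g^Γ = g` a.e. on `𝒟`).
[cite: Iwaniec2002, §2.2, PDF pp. 28–29] -/
theorem lintegral_sq_autExt_le_of_vadd_subset {A : Set ℍ} (m : ℤ)
    (hA : ∀ w ∈ A, (m : ℝ) +ᵥ w ∈ 𝒟) (g : ℍ → ℂ) :
    ∫⁻ w in A, ‖autExt Γℤ 𝒟 g w‖ₑ ^ 2 ≤ ∫⁻ w in 𝒟, ‖g w‖ₑ ^ 2 := by
  have hmp := measurePreserving_vadd (m : ℝ)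
  have hme : MeasurableEmbedding fun z : ℍ => (m : ℝ) +ᵥ z :=
    (isometry_real_vadd (m : ℝ)).isClosedEmbedding.measurableEmbedding
  have e1 : ∫⁻ w in A, ‖autExt Γℤ 𝒟 g w‖ₑ ^ 2 = ∫⁻ w in A, ‖autExt Γℤ 𝒟 g ((m : ℝ) +ᵥ w)‖ₑ ^ 2 := by
    simp_rw [autExt_int_vadd]
  rw [e1, hmp.setLIntegral_comp_emb hme (fun w => ‖autExt Γℤ 𝒟 g w‖ₑ ^ 2) A]
  have hsub : (fun z : ℍ => (m : ℝ) +ᵥ z) '' A ⊆ 𝒟 := by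
    rintro _ ⟨w, hw, rfl⟩; exact hA w hw
  calc ∫⁻ w in (fun z : ℍ => (m : ℝ) +ᵥ z) '' A, ‖autExt Γℤ 𝒟 g w‖ₑ ^ 2
      ≤ ∫⁻ w in 𝒟, ‖autExt Γℤ 𝒟 g w‖ₑ ^ 2 := lintegral_mono_set hsub
    _ = ∫⁻ w in 𝒟, ‖g w‖ₑ ^ 2 := by
        refine lintegral_congr_ae ?_
        filter_upwards [autExt_ae_eq_restrict modular_le_range_toGL neg_one_mem_modular
          isDiscreteSubgroup_modular isHypFundamentalDomain_modular_fd g] with w hw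
        rw [hw]

/-- **Strip mass**: a set of points of height `≥ 1` and real parts in `[n, n+1]` (`n ∈ ℤ`)
carries at most twice the `L²(𝒟)`-mass: `∫_S |g^Γ|² ≤ 2 ∫_𝒟 |g|²` (the strip lies in
`(𝒟 - n) ∪ (𝒟 - n - 1)`). [cite: Iwaniec2002, §2.2, PDF pp. 28–29] -/
theorem lintegral_sq_autExt_strip_le {S : Set ℍ} (n : ℤ)
    (hS : ∀ w ∈ S, 1 ≤ w.im ∧ (n : ℝ) ≤ w.re ∧ w.re ≤ n + 1) (g : ℍ → ℂ) :
    ∫⁻ w in S, ‖autExt Γℤ 𝒟 g w‖ₑ ^ 2 ≤ 2 * ∫⁻ w in 𝒟, ‖g w‖ₑ ^ 2 := by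
  set A := {w ∈ S | w.re ≤ n + 1 / 2} with hAdef
  set B := {w ∈ S | (n : ℝ) + 1 / 2 < w.re} with hBdef
  have hAB : S ⊆ A ∪ B := by
    intro w hw
    by_cases h : w.re ≤ n + 1 / 2
    · exact Or.inl ⟨hw, h⟩
    · exact Or.inr ⟨hw, not_le.mp h⟩
  have hA : ∀ w ∈ A, ((-n : ℤ) : ℝ) +ᵥ w ∈ 𝒟 := by
    rintro w ⟨hwS, hwre⟩
    obtain ⟨him, hre1, _⟩ := hS w hwS
    refine mem_fd_of_one_le_im (by rwa [vadd_im]) ?_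
    rw [vadd_re, abs_le]
    push_cast
    constructor <;> linarith
  have hB : ∀ w ∈ B, ((-(n + 1) : ℤ) : ℝ) +ᵥ w ∈ 𝒟 := by
    rintro w ⟨hwS, hwre⟩
    obtain ⟨him, _, hre2⟩ := hS w hwS
    refine mem_fd_of_one_le_im (by rwa [vadd_im]) ?_
    rw [vadd_re, abs_le]
    push_cast
    constructor <;> linarith
  calc ∫⁻ w in S, ‖autExt Γℤ 𝒟 g w‖ₑ ^ 2 ≤ ∫⁻ w in A ∪ B, ‖autExt Γℤ 𝒟 g w‖ₑ ^ 2 :=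
        lintegral_mono_set hAB
    _ ≤ (∫⁻ w in A, ‖autExt Γℤ 𝒟 g w‖ₑ ^ 2) + ∫⁻ w in B, ‖autExt Γℤ 𝒟 g w‖ₑ ^ 2 :=
        lintegral_union_le _ _ _
    _ ≤ (∫⁻ w in 𝒟, ‖g w‖ₑ ^ 2) + ∫⁻ w in 𝒟, ‖g w‖ₑ ^ 2 :=
        add_le_add (lintegral_sq_autExt_le_of_vadd_subset (-n) hA g)
          (lintegral_sq_autExt_le_of_vadd_subset (-(n + 1)) hB g)
    _ = 2 * ∫⁻ w in 𝒟, ‖g w‖ₑ ^ 2 := by ring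

end CuspMass

/-! ## 4. Hyperbolic balls high in the cusp -/

section CuspBalls

local notation "Γℤ" => (𝒮ℒ : Subgroup (GL (Fin 2) ℝ))

/-- The hyperbolic measure of a ball does not depend on its centre (transitivity of `SL₂(ℝ)` and
invariance of `μ`). [cite: Iwaniec2002, (1.8), PDF p. 10] -/
theorem volume_closedBall_eq (z : ℍ) (r : ℝ) :
    volume (Metric.closedBall z r) = volume (Metric.closedBall UpperHalfPlane.I r) := by
  obtain ⟨g, rfl⟩ := MulAction.exists_smul_eq SL(2, ℝ) UpperHalfPlane.I z
  have e1 : Metric.closedBall (g • UpperHalfPlane.I) r = (g • ·) '' Metric.closedBall UpperHalfPlane.I r :=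
    ((IsometryEquiv.constSMul g).image_closedBall UpperHalfPlane.I r).symm
  have e2 : (g • ·) '' Metric.closedBall UpperHalfPlane.I r =
      (Matrix.SpecialLinearGroup.toGL g : GL (Fin 2) ℝ) • Metric.closedBall UpperHalfPlane.I r := by
    rw [← Set.image_smul]; rfl
  rw [e1, e2, measure_smul]

/-- Hyperbolic balls have finite measure. [folklore] -/
theorem volume_closedBall_lt_top (z : ℍ) (r : ℝ) : volume (Metric.closedBall z r) < ∞ :=
  (isCompact_closedBall z r).measure_lt_top

/-- On `B(z, r)`: `Im w ≥ Im z · e^{-r}` and `|Re w - Re z| ≤ Im z · (e^r - 1)`. [folklore] -/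
theorem abs_re_sub_le_of_mem_closedBall {z w : ℍ} {r : ℝ} (hw : w ∈ Metric.closedBall z r) :
    |w.re - z.re| ≤ z.im * (Real.exp r - 1) := by
  have hd : dist w z ≤ r := Metric.mem_closedBall.mp hw
  calc |w.re - z.re| = |((w : ℂ) - (z : ℂ)).re| := by simp
    _ ≤ ‖(w : ℂ) - (z : ℂ)‖ := Complex.abs_re_le_norm _
    _ = dist (w : ℂ) (z : ℂ) := (dist_eq_norm _ _).symm
    _ ≤ z.im * (Real.exp (dist w z) - 1) := dist_coe_le w z
    _ ≤ z.im * (Real.exp r - 1) := by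
        gcongr

/-- **Mass of `g^Γ` on a ball high in the cusp**: if `Im z · e^{-r} ≥ 1` then
`∫_{B(z, r)} |g^Γ|² ≤ (4 Im z (e^r - 1) + 8) ∫_𝒟 |g|²` — the ball is covered by
`2⌈Im z (e^r - 1)⌉ + 2` vertical strips of width one at height `≥ 1`, each carrying twice the mass
of `𝒟` (`lintegral_sq_autExt_strip_le`). [cite: Iwaniec2002, §2.2 & Lemma 2.10, PDF pp. 28–29, 37] -/
theorem lintegral_sq_autExt_closedBall_le {z : ℍ} {r : ℝ} (hr : 0 ≤ r)
    (hz : 1 ≤ z.im * Real.exp (-r)) (g : ℍ → ℂ) :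
    ∫⁻ w in Metric.closedBall z r, ‖autExt Γℤ 𝒟 g w‖ₑ ^ 2 ≤
      ENNReal.ofReal (4 * (z.im * (Real.exp r - 1)) + 8) * ∫⁻ w in 𝒟, ‖g w‖ₑ ^ 2 := by
  set W : ℝ := z.im * (Real.exp r - 1) with hW
  have hW0 : 0 ≤ W := mul_nonneg z.im_pos.le (by linarith [Real.one_le_exp hr])
  set N : ℕ := ⌈W⌉₊ with hN
  have hNW : (N : ℝ) < W + 1 := Nat.ceil_lt_add_one hW0
  have hWN : W ≤ N := Nat.le_ceil W
  set x0 : ℤ := ⌊z.re⌋ with hx0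
  -- the strips
  set S : Fin (2 * N + 2) → Set ℍ := fun j =>
    {w ∈ Metric.closedBall z r | ((x0 - N + j : ℤ) : ℝ) ≤ w.re ∧ w.re ≤ ((x0 - N + j : ℤ) : ℝ) + 1}
    with hS
  have hcover : Metric.closedBall z r ⊆ ⋃ j, S j := by
    intro w hw
    have hre := abs_re_sub_le_of_mem_closedBall hw
    rw [← hW, abs_le] at hre
    have hfl := Int.floor_le z.re
    have hfl' := Int.lt_floor_add_one z.re
    have hwl := Int.floor_le w.re
    have hwl' := Int.lt_floor_add_one w.re
    -- the index of the strip containing `w`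
    have hj0 : x0 - N ≤ ⌊w.re⌋ := by
      apply Int.le_floor.mpr
      push_cast
      rw [hx0]
      linarith
    have hj1 : ⌊w.re⌋ ≤ x0 + N := by
      have : (⌊w.re⌋ : ℝ) < (x0 : ℝ) + N + 1 := by rw [hx0]; linarith
      have : ⌊w.re⌋ < x0 + N + 1 := by exact_mod_cast this
      omega
    set j : ℕ := (⌊w.re⌋ - (x0 - N)).toNat with hj
    have hjlt : j < 2 * N + 2 := by
      rw [hj]; omega
    refine Set.mem_iUnion.mpr ⟨⟨j, hjlt⟩, hw, ?_⟩
    have ej : (x0 - N + ((⟨j, hjlt⟩ : Fin (2 * N + 2)) : ℕ) : ℤ) = ⌊w.re⌋ := by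
      simp only [hj]
      omega
    rw [ej]
    exact ⟨hwl, hwl'.le⟩
  -- each strip carries at most twice the mass
  have hstrip : ∀ j, ∫⁻ w in S j, ‖autExt Γℤ 𝒟 g w‖ₑ ^ 2 ≤ 2 * ∫⁻ w in 𝒟, ‖g w‖ₑ ^ 2 := by
    intro j
    refine lintegral_sq_autExt_strip_le (x0 - N + j) (fun w hw => ⟨?_, hw.2.1, hw.2.2⟩) g
    have h := im_ge_of_mem_closedBall hw.1
    exact hz.trans h
  calc ∫⁻ w in Metric.closedBall z r, ‖autExt Γℤ 𝒟 g w‖ₑ ^ 2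
      ≤ ∫⁻ w in ⋃ j, S j, ‖autExt Γℤ 𝒟 g w‖ₑ ^ 2 := lintegral_mono_set hcover
    _ ≤ ∑' j, ∫⁻ w in S j, ‖autExt Γℤ 𝒟 g w‖ₑ ^ 2 := lintegral_iUnion_le _ _
    _ = ∑ j, ∫⁻ w in S j, ‖autExt Γℤ 𝒟 g w‖ₑ ^ 2 := tsum_fintype _
    _ ≤ ∑ _j : Fin (2 * N + 2), 2 * ∫⁻ w in 𝒟, ‖g w‖ₑ ^ 2 := Finset.sum_le_sum fun j _ => hstrip j
    _ = ((2 * N + 2 : ℕ) : ℝ≥0∞) * (2 * ∫⁻ w in 𝒟, ‖g w‖ₑ ^ 2) := by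
        rw [Finset.sum_const, Finset.card_univ, Fintype.card_fin, nsmul_eq_mul]
    _ = ENNReal.ofReal (4 * N + 4) * ∫⁻ w in 𝒟, ‖g w‖ₑ ^ 2 := by
        rw [← mul_assoc]
        congr 1
        rw [show (4 * (N : ℝ) + 4) = ((4 * N + 4 : ℕ) : ℝ) by push_cast; ring, ENNReal.ofReal_natCast]
        push_cast
        ring
    _ ≤ ENNReal.ofReal (4 * W + 8) * ∫⁻ w in 𝒟, ‖g w‖ₑ ^ 2 := by
        refine mul_le_mul_of_nonneg_right (ENNReal.ofReal_le_ofReal ?_) bot_le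
        linarith

end CuspBalls

/-! ## 5. Cusp forms: `T_k g` is small high in the cusp -/

section CuspDecay

local notation "Γℤ" => (𝒮ℒ : Subgroup (GL (Fin 2) ℝ))

variable {k : ℝ → ℝ} {L : ℝ≥0} {M : ℝ}

/-- `L_k G` is continuous for a Lipschitz test kernel `k` and `G ∈ L¹_loc(ℍ)`.
[cite: Iwaniec2002, §1.8, PDF pp. 20–21] -/
theorem continuous_invariantOperator (hk : IsTestKernel k) (hL : LipschitzWith L k)
    (hM : ∀ u, M ≤ u → k u = 0) {G : ℍ → ℂ} (hG : LocallyIntegrable G) :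
    Continuous (invariantOperator k G) := by
  rw [Metric.continuous_iff]
  intro z ε hε
  set A : ℝ := oscConst L M * ∫ w in Metric.closedBall z (kernelRadius M + 1), ‖G w‖ with hA
  have hA0 : 0 ≤ A := mul_nonneg (oscConst_nonneg L M) (integral_nonneg fun w => norm_nonneg _)
  refine ⟨min 1 (ε / (A + 1)), lt_min one_pos (div_pos hε (by linarith)), fun z' hz' => ?_⟩
  have h1 : dist z z' ≤ 1 := by rw [dist_comm]; exact (hz'.trans_le (min_le_left _ _)).le
  have h2 : dist z z' < ε / (A + 1) := by rw [dist_comm]; exact hz'.trans_le (min_le_right _ _)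
  rw [dist_eq_norm, ← norm_neg, neg_sub]
  calc ‖invariantOperator k G z - invariantOperator k G z'‖
      ≤ oscConst L M * dist z z' * ∫ w in Metric.closedBall z (kernelRadius M + 1), ‖G w‖ :=
        norm_invariantOperator_sub_le hk hL hM hG h1
    _ = A * dist z z' := by rw [hA]; ring
    _ ≤ A * (ε / (A + 1)) := mul_le_mul_of_nonneg_left h2.le hA0
    _ < ε := by
        rw [mul_div_assoc']
        rw [div_lt_iff₀ (by linarith)]
        nlinarith

/-- **The key pointwise bound**: a continuous function with vanishing cusp mean at `z` is bounded
at `z` by its oscillation along the horocycle piece `{z + ξ : 0 ≤ ξ ≤ 1}`: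
`Φ(z) = ∫_0^1 (Φ(z) - Φ(z + ξ)) dξ`. [cite: Iwaniec2002, (3.2) & §4.2, PDF pp. 40–41, 49–51] -/
theorem norm_le_of_cuspMean_eq_zero {Φ : ℍ → ℂ} (hΦ : Continuous Φ) {z : ℍ} (h0 : cuspMean Φ z = 0)
    {C : ℝ} (hC : ∀ ξ ∈ Icc (0 : ℝ) 1, ‖Φ z - Φ (ξ +ᵥ z)‖ ≤ C) : ‖Φ z‖ ≤ C := by
  have hcont : Continuous fun ξ : ℝ => Φ (ξ +ᵥ z) :=
    hΦ.comp (continuous_vadd₂.comp (continuous_id.prodMk continuous_const))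
  have hii : IntervalIntegrable (fun ξ : ℝ => Φ (ξ +ᵥ z)) volume 0 1 := hcont.intervalIntegrable 0 1
  have e : Φ z = ∫ ξ in (0 : ℝ)..1, (Φ z - Φ (ξ +ᵥ z)) := by
    rw [intervalIntegral.integral_sub intervalIntegrable_const hii, intervalIntegral.integral_const]
    rw [← cuspMean_apply, h0]
    simp
  rw [e]
  have h := intervalIntegral.norm_integral_le_of_norm_le_const (a := (0 : ℝ)) (b := 1) (C := C)
    (f := fun ξ : ℝ => Φ z - Φ (ξ +ᵥ z)) (fun ξ hξ => hC ξ ?_)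
  · simpa using h
  · rw [Set.uIoc_of_le zero_le_one] at hξ
    exact ⟨hξ.1.le, hξ.2⟩

/-- The constant of the cusp decay estimate. [folklore] -/
def cuspConst (L : ℝ≥0) (M : ℝ) : ℝ :=
  oscConst L M * Real.sqrt ((volume (Metric.closedBall UpperHalfPlane.I (kernelRadius M + 1))).toReal) *
    Real.sqrt (4 * (Real.exp (kernelRadius M + 1) - 1) + 8)

/-- `cuspConst L M ≥ 0`. [folklore] -/
theorem cuspConst_nonneg (L : ℝ≥0) (M : ℝ) : 0 ≤ cuspConst L M := by
  unfold cuspConst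
  have := oscConst_nonneg L M
  positivity

/-- **Cusp decay of `T_k g` for `g ∈ 𝓒` (Iwaniec, Proposition 4.3 with Corollary 4.4 and
Proposition 4.5 for `SL₂(ℤ)`): for a Lipschitz test kernel `k` (vanishing on `[M, ∞)`),
`g ∈ L²(𝒟)` with `(g^Γ)₀ = 0` a.e., and `Im z ≥ e^{R_M + 1}`,
`|T_k g(z)| ≤ C_{k} (Im z)^{-1/2} ‖g‖_{L²(𝒟)}`. In the book the kernel is modified by its principal
part `H(z, w)` (which annihilates cusp forms, (4.8)) and the difference `K̂ = K - H` is shown to be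
bounded via Euler–MacLaurin; here the same cancellation is used in the form
`T_k g(z) = ∫_0^1 (T_k g(z) - T_k g(z + ξ)) dξ` (the cusp mean of `T_k g = L_k g^Γ` vanishes,
`(L_k G)₀ = L_k(G₀) = 0`), the oscillation of `L_k g^Γ` over the horocycle piece of hyperbolic
length `1/Im z` being `≪ (Im z)⁻¹ ∫_{B(z, R_M+1)} |g^Γ| ≪ (Im z)^{-1/2} ‖g‖`.
[cite: Iwaniec2002, Prop. 4.3, Cor. 4.4, Prop. 4.5, PDF pp. 49–51] -/
theorem norm_kernelOp_le_of_cuspidal (hk : IsTestKernel k) (hL : LipschitzWith L k)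
    (hM : ∀ u, M ≤ u → k u = 0) {g : ℍ → ℂ} (hg : MemLp g 2 (volume.restrict 𝒟))
    (hcusp : cuspMean (autExt Γℤ 𝒟 g) =ᵐ[volume] 0) {z : ℍ}
    (hz : Real.exp (kernelRadius M + 1) ≤ z.im) :
    ‖kernelOp Γℤ 𝒟 k g z‖ ≤
      cuspConst L M * z.im ^ (-(1 / 2 : ℝ)) * Real.sqrt ((∫⁻ w in 𝒟, ‖g w‖ₑ ^ 2).toReal) := by
  have hΓ := modular_le_range_toGL
  have hneg := neg_one_mem_modular
  have hd := isDiscreteSubgroup_modular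
  have hF := isHypFundamentalDomain_modular_fd
  set R := kernelRadius M with hR
  set G : ℍ → ℂ := autExt Γℤ 𝒟 g with hGdef
  have hGl : LocallyIntegrable G := locallyIntegrable_autExt hΓ hneg hd hF hg
  have hGm : AEStronglyMeasurable G volume := aestronglyMeasurable_autExt hΓ hneg hd hF hg.1
  set Φ : ℍ → ℂ := invariantOperator k G with hΦdef
  have hΦc : Continuous Φ := continuous_invariantOperator hk hL hM hGl
  -- `T_k g = L_k G` and its cusp mean vanishes identically
  have eΦ : kernelOp Γℤ 𝒟 k g z = Φ z := kernelOp_eq_invariantOperator hΓ hneg hd hF hk hg z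
  have h0 : cuspMean Φ z = 0 := by
    rw [hΦdef, cuspMean_invariantOperator hk hGl z]
    exact invariantOperator_of_ae_eq_zero hcusp z
  -- sizes
  have hR0 : 0 ≤ R := kernelRadius_nonneg M
  have hy1 : 1 ≤ z.im := le_trans (by have := Real.one_le_exp (by linarith : (0:ℝ) ≤ R + 1); linarith) hz
  have hy0 : 0 < z.im := z.im_pos
  have hzr : 1 ≤ z.im * Real.exp (-(R + 1)) := by
    rw [Real.exp_neg, ← div_eq_mul_inv, le_div_iff₀ (Real.exp_pos _), one_mul]
    exact hz
  set B := Metric.closedBall z (R + 1) with hB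
  set m : ℝ := (∫⁻ w in 𝒟, ‖g w‖ₑ ^ 2).toReal with hm
  have hmfin : ∫⁻ w in 𝒟, ‖g w‖ₑ ^ 2 ≠ ∞ := (lintegral_enorm_sq_lt_top hg).ne
  set V : ℝ := (volume (Metric.closedBall UpperHalfPlane.I (R + 1))).toReal with hV
  -- mass of `G` on the ball `B`
  have hmass := lintegral_sq_autExt_closedBall_le (z := z) (r := R + 1) (by linarith) hzr g
  have hBfin : ∫⁻ w in B, ‖G w‖ₑ ^ 2 ≠ ∞ := by
    refine (lt_of_le_of_lt hmass (ENNReal.mul_lt_top ENNReal.ofReal_lt_top (lt_top_iff_ne_top.mpr hmfin))).ne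
  have hvolB : volume B ≠ ∞ := (volume_closedBall_lt_top z (R + 1)).ne
  have hint : ∫ w in B, ‖G w‖ ≤ Real.sqrt V * Real.sqrt ((4 * (z.im * (Real.exp (R + 1) - 1)) + 8) * m) := by
    refine (integral_norm_le_sqrt_mul_sqrt hvolB hGm hBfin).trans ?_
    rw [hB, volume_closedBall_eq z (R + 1), ← hV]
    gcongr
    have he : 0 ≤ Real.exp (R + 1) - 1 := by linarith [Real.one_le_exp (by linarith : (0:ℝ) ≤ R + 1)]
    have hpos : (0:ℝ) ≤ 4 * (z.im * (Real.exp (R + 1) - 1)) + 8 := by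
      have := mul_nonneg hy0.le he; linarith
    rw [hm, ← ENNReal.toReal_ofReal hpos, ← ENNReal.toReal_mul]
    exact ENNReal.toReal_mono (ENNReal.mul_ne_top ENNReal.ofReal_ne_top hmfin) hmass
  -- oscillation along the horocycle
  have hosc : ∀ ξ ∈ Icc (0 : ℝ) 1, ‖Φ z - Φ (ξ +ᵥ z)‖ ≤
      oscConst L M * (1 / z.im) * ∫ w in B, ‖G w‖ := by
    intro ξ hξ
    have hdist : dist z (ξ +ᵥ z) ≤ 1 / z.im := by
      rw [dist_comm]
      refine (dist_vadd_self_le ξ z).trans ?_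
      rw [abs_of_nonneg hξ.1]
      exact div_le_div_of_nonneg_right hξ.2 hy0.le
    have hdist1 : dist z (ξ +ᵥ z) ≤ 1 := hdist.trans (by rw [div_le_one hy0]; exact hy1)
    refine (norm_invariantOperator_sub_le hk hL hM hGl hdist1).trans ?_
    have hI0 : 0 ≤ ∫ w in B, ‖G w‖ := integral_nonneg fun w => norm_nonneg _
    gcongr
    exact oscConst_nonneg L M
  have hmain := norm_le_of_cuspMean_eq_zero hΦc h0 hosc
  rw [eΦ]
  refine hmain.trans ?_
  -- arithmetic: `osc · (1/y) · √V · √((4y(e^{R+1}-1)+8) m) ≤ cuspConst · y^{-1/2} · √m`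
  have hsq : Real.sqrt ((4 * (z.im * (Real.exp (R + 1) - 1)) + 8) * m) ≤
      Real.sqrt z.im * Real.sqrt (4 * (Real.exp (R + 1) - 1) + 8) * Real.sqrt m := by
    have he : 0 ≤ Real.exp (R + 1) - 1 := by linarith [Real.one_le_exp (by linarith : (0:ℝ) ≤ R + 1)]
    have h48 : (0:ℝ) ≤ 4 * (Real.exp (R + 1) - 1) + 8 := by positivity
    rw [← Real.sqrt_mul hy0.le, ← Real.sqrt_mul (mul_nonneg hy0.le h48)]
    apply Real.sqrt_le_sqrt
    have hm0 : 0 ≤ m := ENNReal.toReal_nonneg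
    nlinarith
  have hy_half : (1 / z.im) * Real.sqrt z.im = z.im ^ (-(1 / 2 : ℝ)) := by
    rw [Real.sqrt_eq_rpow, Real.rpow_neg hy0.le, one_div, ← Real.rpow_neg_one,
      ← Real.rpow_add hy0]
    norm_num
    rw [Real.rpow_neg hy0.le]
  calc oscConst L M * (1 / z.im) * ∫ w in B, ‖G w‖
      ≤ oscConst L M * (1 / z.im) * (Real.sqrt V * (Real.sqrt z.im * Real.sqrt (4 * (Real.exp (R + 1) - 1) + 8) * Real.sqrt m)) := by
        have : 0 ≤ oscConst L M * (1 / z.im) := mul_nonneg (oscConst_nonneg L M) (one_div_pos.mpr hy0).le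
        exact mul_le_mul_of_nonneg_left (hint.trans (mul_le_mul_of_nonneg_left hsq (Real.sqrt_nonneg _))) this
    _ = cuspConst L M * ((1 / z.im) * Real.sqrt z.im) * Real.sqrt m := by
        rw [cuspConst]; ring
    _ = cuspConst L M * z.im ^ (-(1 / 2 : ℝ)) * Real.sqrt m := by rw [hy_half]

end CuspDecay

/-! ## 6. The truncated fundamental domain and uniform local bounds -/

section Truncation

local notation "Γℤ" => (𝒮ℒ : Subgroup (GL (Fin 2) ℝ))

/-- The truncated fundamental domain `𝒟_Y = {w ∈ 𝒟 : Im w ≤ Y}` (Iwaniec's central part `F(Y)`,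
(2.3)). [cite: Iwaniec2002, (2.3), PDF p. 30] -/
def fdTrunc (Y : ℝ) : Set ℍ := {w ∈ 𝒟 | w.im ≤ Y}

/-- On `𝒟` the height is at least `1/2` (indeed `≥ √3/2`). [folklore] -/
theorem half_le_im_of_mem_fd {w : ℍ} (hw : w ∈ 𝒟) : 1 / 2 ≤ w.im := by
  obtain ⟨h1, h2⟩ := hw
  rw [Complex.normSq_apply, UpperHalfPlane.coe_re, UpperHalfPlane.coe_im] at h1
  rw [abs_le] at h2
  have hi := w.im_pos
  nlinarith

/-- `𝒟_Y` is measurable. [folklore] -/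
theorem measurableSet_fdTrunc (Y : ℝ) : MeasurableSet (fdTrunc Y) :=
  ModularGroup.isClosed_fd.measurableSet.inter (isClosed_le UpperHalfPlane.continuous_im continuous_const).measurableSet

/-- `𝒟_Y ⊆ B(i, 2(|Y| + 2))`. [folklore] -/
theorem fdTrunc_subset_closedBall (Y : ℝ) :
    fdTrunc Y ⊆ Metric.closedBall UpperHalfPlane.I (2 * (|Y| + 2)) := by
  intro w hw
  obtain ⟨hwD, hwY⟩ := hw
  have him := half_le_im_of_mem_fd hwD
  have hre : |w.re| ≤ 1 / 2 := hwD.2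
  rw [Metric.mem_closedBall]
  have h1 := dist_le_dist_coe_div_sqrt w UpperHalfPlane.I
  rw [UpperHalfPlane.I_im, mul_one] at h1
  have hsqrt : 1 / 2 ≤ Real.sqrt w.im := by
    rw [show (1 / 2 : ℝ) = Real.sqrt (1 / 4) by
      rw [show (1 / 4 : ℝ) = (1 / 2) ^ 2 by norm_num, Real.sqrt_sq (by norm_num)]]
    exact Real.sqrt_le_sqrt (by linarith)
  have hnum : dist (w : ℂ) (UpperHalfPlane.I : ℂ) ≤ |Y| + 2 := by
    rw [Complex.dist_eq]
    have e : (w : ℂ) - (UpperHalfPlane.I : ℂ) = ⟨w.re, w.im - 1⟩ := by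
      apply Complex.ext <;> simp
    rw [e]
    calc ‖(⟨w.re, w.im - 1⟩ : ℂ)‖ ≤ |w.re| + |w.im - 1| := Complex.norm_le_abs_re_add_abs_im _
      _ ≤ 1 / 2 + (|Y| + 1) := by
          refine add_le_add hre ?_
          rw [abs_le]
          constructor
          · linarith [abs_nonneg Y]
          · linarith [le_abs_self Y]
      _ ≤ |Y| + 2 := by linarith
  calc dist w UpperHalfPlane.I ≤ dist (w : ℂ) (UpperHalfPlane.I : ℂ) / Real.sqrt w.im := h1
    _ ≤ (|Y| + 2) / (1 / 2) := by
        gcongr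
    _ = 2 * (|Y| + 2) := by ring

/-- `𝒟_Y` is compact. [folklore] -/
theorem isCompact_fdTrunc (Y : ℝ) : IsCompact (fdTrunc Y) :=
  (isCompact_closedBall UpperHalfPlane.I (2 * (|Y| + 2))).of_isClosed_subset
    (ModularGroup.isClosed_fd.inter (isClosed_le UpperHalfPlane.continuous_im continuous_const))
    (fdTrunc_subset_closedBall Y)

/-- `‖g‖ = √(∫_𝒟 |g|²)` in `L²(𝒟)`. [folklore] -/
theorem norm_eq_sqrt_lintegral (g : Lp ℂ 2 ((volume : Measure ℍ).restrict 𝒟)) :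
    ‖g‖ = Real.sqrt ((∫⁻ w in 𝒟, ‖g w‖ₑ ^ 2).toReal) := by
  rw [← toReal_enorm, ← lintegral_rpow_eq_enorm g, ← ENNReal.toReal_rpow, Real.sqrt_eq_rpow]

/-- `‖g‖² = ∫_𝒟 |g|²` in `L²(𝒟)`. [folklore] -/
theorem sq_norm_eq_toReal_lintegral (g : Lp ℂ 2 ((volume : Measure ℍ).restrict 𝒟)) :
    ‖g‖ ^ 2 = (∫⁻ w in 𝒟, ‖g w‖ₑ ^ 2).toReal := by
  rw [norm_eq_sqrt_lintegral, Real.sq_sqrt ENNReal.toReal_nonneg]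

variable {k : ℝ → ℝ} {L : ℝ≥0} {M : ℝ}

/-- The orbit-count bound of `AutomorphicKernelOperators.lean` about `i`, as a real number. [folklore] -/
def orbitBound (D : ℝ) : ℝ :=
  (∑' δ : Γℤ, {δ : Γℤ | dist ((δ : GL (Fin 2) ℝ) • UpperHalfPlane.I) UpperHalfPlane.I ≤ 2 * D}.indicator
    (fun _ => (1 : ℝ≥0∞)) δ).toReal

/-- **Uniform local `L¹` bound**: for `w ∈ 𝒟_Y` and `g ∈ L²(𝒟)`,
`∫_{B(w, R_M + 1)} |g^Γ| ≤ A_Y ‖g‖` with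
`A_Y = √μ(B(i, R_M+1)) · √(N/2)`, `N` the orbit count for the ball `B(i, 2(|Y|+2) + R_M + 1)`.
[cite: Iwaniec2002, §2.2, PDF pp. 28–29] -/
theorem integral_norm_autExt_closedBall_le (M Y : ℝ) {g : ℍ → ℂ}
    (hg : MemLp g 2 (volume.restrict 𝒟)) {w : ℍ} (hw : w ∈ fdTrunc Y) :
    ∫ v in Metric.closedBall w (kernelRadius M + 1), ‖autExt Γℤ 𝒟 g v‖ ≤
      Real.sqrt ((volume (Metric.closedBall UpperHalfPlane.I (kernelRadius M + 1))).toReal) *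
        Real.sqrt (orbitBound (2 * (|Y| + 2) + (kernelRadius M + 1)) / 2) *
        Real.sqrt ((∫⁻ v in 𝒟, ‖g v‖ₑ ^ 2).toReal) := by
  have hΓ := modular_le_range_toGL
  have hneg := neg_one_mem_modular
  have hd := isDiscreteSubgroup_modular
  have hF := isHypFundamentalDomain_modular_fd
  set R := kernelRadius M with hR
  set D := 2 * (|Y| + 2) + (R + 1) with hD
  set B := Metric.closedBall w (R + 1) with hB
  set G := autExt Γℤ 𝒟 g with hG
  have hGm : AEStronglyMeasurable G volume := aestronglyMeasurable_autExt hΓ hneg hd hF hg.1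
  have hmfin : ∫⁻ v in 𝒟, ‖g v‖ₑ ^ 2 ≠ ∞ := (lintegral_enorm_sq_lt_top hg).ne
  -- `B ⊆ B(i, D)`
  have hBsub : B ⊆ Metric.closedBall UpperHalfPlane.I D := by
    intro v hv
    have h1 := fdTrunc_subset_closedBall Y hw
    rw [Metric.mem_closedBall] at hv h1 ⊢
    calc dist v UpperHalfPlane.I ≤ dist v w + dist w UpperHalfPlane.I := dist_triangle _ _ _
      _ ≤ (R + 1) + 2 * (|Y| + 2) := add_le_add hv h1
      _ = D := by rw [hD]; ring
  set N : ℝ≥0∞ := ∑' δ : Γℤ, {δ : Γℤ | dist ((δ : GL (Fin 2) ℝ) • UpperHalfPlane.I) UpperHalfPlane.I ≤ 2 * D}.indicator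
    (fun _ => (1 : ℝ≥0∞)) δ with hN
  have hNfin : N < ∞ := tsum_indicator_dist_le_lt_top hΓ hd UpperHalfPlane.I (2 * D)
  have hloc := lintegral_enorm_sq_autExt_le hΓ hneg hd hF (measurableSet_closedBall (x := w) (ε := R + 1))
    hBsub hg.1
  -- `∫⁻_B |G|² ≤ (N/2) ∫⁻_𝒟 |g|²`
  have hB2 : ∫⁻ v in B, ‖G v‖ₑ ^ 2 ≤ N / 2 * ∫⁻ v in 𝒟, ‖g v‖ₑ ^ 2 := by
    rw [← ENNReal.mul_div_right_comm,
      ENNReal.le_div_iff_mul_le (Or.inl two_ne_zero) (Or.inl ENNReal.ofNat_ne_top), mul_comm]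
    exact hloc
  have hBfin : ∫⁻ v in B, ‖G v‖ₑ ^ 2 ≠ ∞ := by
    refine (lt_of_le_of_lt hB2 (ENNReal.mul_lt_top ?_ (lt_top_iff_ne_top.mpr hmfin))).ne
    exact ENNReal.div_lt_top hNfin.ne (by norm_num)
  have hvolB : volume B ≠ ∞ := (volume_closedBall_lt_top w (R + 1)).ne
  refine (integral_norm_le_sqrt_mul_sqrt hvolB hGm hBfin).trans ?_
  rw [hB, volume_closedBall_eq w (R + 1), mul_assoc]
  gcongr
  rw [← Real.sqrt_mul (by unfold orbitBound; positivity)]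
  apply Real.sqrt_le_sqrt
  have e : orbitBound D / 2 * (∫⁻ v in 𝒟, ‖g v‖ₑ ^ 2).toReal = (N / 2 * ∫⁻ v in 𝒟, ‖g v‖ₑ ^ 2).toReal := by
    rw [ENNReal.toReal_mul, ENNReal.toReal_div, orbitBound, ← hN]
    norm_num
  rw [e]
  exact ENNReal.toReal_mono (ENNReal.mul_ne_top (ENNReal.div_lt_top hNfin.ne (by norm_num)).ne hmfin) hB2

end Truncation

/-! ## 7. Compactness of `T_k` on the cuspidal subspace -/

section Compact

local notation "Γℤ" => (𝒮ℒ : Subgroup (GL (Fin 2) ℝ))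
set_option quotPrecheck false in
/-- The measure of `L²(𝒟)`: the hyperbolic measure restricted to `𝒟`. -/
local notation "μ𝒟" => MeasureTheory.Measure.restrict (volume : Measure ℍ) (ModularGroup.fd)

variable {k : ℝ → ℝ} {L : ℝ≥0} {M : ℝ}

/-- The invariant integral operator `T_k` of `AutomorphicKernelOperators.lean` on `L²(𝒟)` for the
modular group `Γ = SL₂(ℤ)`, `F = 𝒟`. [cite: Iwaniec2002, §4.1–§4.2, PDF pp. 48–49] -/
abbrev modularKernelCLM (hk : IsTestKernel k) (hkc : Continuous k) : Lp ℂ 2 μ𝒟 →L[ℂ] Lp ℂ 2 μ𝒟 :=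
  kernelCLM modular_le_range_toGL neg_one_mem_modular isDiscreteSubgroup_modular
    isHypFundamentalDomain_modular_fd hk hkc

/-- `L²(𝒟)` lives on a finite measure space (`|𝒟| = π/3`). [cite: Iwaniec2002, §2.2, PDF p. 29] -/
theorem isFiniteMeasure_restrict_fd : IsFiniteMeasure μ𝒟 :=
  ⟨by rw [Measure.restrict_apply_univ]; exact volume_modular_fd_lt_top⟩

/-- `T_k` is linear pointwise: `T_k(g - g')(z) = T_k g(z) - T_k g'(z)` for `g, g' ∈ L²(𝒟)`. [folklore] -/
theorem kernelOp_coe_sub (hk : IsTestKernel k) (hkc : Continuous k) (g g' : Lp ℂ 2 μ𝒟) (z : ℍ) :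
    kernelOp Γℤ 𝒟 k (⇑(g - g')) z = kernelOp Γℤ 𝒟 k g z - kernelOp Γℤ 𝒟 k g' z := by
  have hΓ := modular_le_range_toGL
  have hneg := neg_one_mem_modular
  have hd := isDiscreteSubgroup_modular
  have hF := isHypFundamentalDomain_modular_fd
  have e1 : kernelOp Γℤ 𝒟 k (⇑(g - g')) = kernelOp Γℤ 𝒟 k (⇑g + (-1 : ℂ) • ⇑g') := by
    refine kernelOp_congr_ae ?_
    filter_upwards [Lp.coeFn_sub g g'] with w hw
    rw [hw, Pi.sub_apply, Pi.add_apply, Pi.smul_apply, smul_eq_mul]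
    ring
  rw [e1, kernelOp_add hΓ hneg hd hF hk hkc (Lp.memLp g) ((Lp.memLp g').const_smul (-1)),
    kernelOp_smul]
  simp only [Pi.add_apply, Pi.smul_apply, smul_eq_mul]
  ring

/-- `y^{-1/2} = 1/√y` for `y > 0`. [folklore] -/
theorem rpow_neg_one_half_eq_one_div_sqrt {y : ℝ} (hy : 0 < y) : y ^ (-(1 / 2 : ℝ)) = 1 / Real.sqrt y := by
  rw [Real.sqrt_eq_rpow, Real.rpow_neg hy.le, inv_eq_one_div]

/-- **`T_k` is a compact operator on the cuspidal subspace** (Iwaniec §4.2–§4.3: on `𝓒(Γ\ℍ)` the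
operator `L` coincides with `L̂`, whose kernel `K̂ = K - H` is bounded on `F × F`, so that `L̂` is
of Hilbert–Schmidt type, hence compact — Propositions 4.3, 4.5, Corollary 4.4 and the appeal to
the Hilbert–Schmidt theorem opening §4.3), for `Γ = SL₂(ℤ)` and every Lipschitz test kernel `k`:
the composite `T_k ∘ ι : 𝓒 → L²(𝒟)` is compact. Proof here: the image of the unit ball of `𝓒`
is totally bounded in `L²(𝒟)` — high in the cusp `|T_k g| ≤ C_k (Im z)^{-1/2} ‖g‖`
(`norm_kernelOp_le_of_cuspidal`), and on the compact part `𝒟_Y` the family `{T_k g}` is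
uniformly bounded and uniformly equicontinuous (`norm_invariantOperator_sub_le`), so finitely many
point evaluations determine `T_k g` up to `ε` in `L²(𝒟)`.
[cite: Iwaniec2002, Prop. 4.3, Cor. 4.4, Prop. 4.5 & §4.3, PDF pp. 49–52] -/
theorem isCompactOperator_kernelCLM_comp_cuspSubtype (hk : IsTestKernel k) (hL : LipschitzWith L k)
    (hM : ∀ u, M ≤ u → k u = 0) :
    IsCompactOperator ((modularKernelCLM hk hL.continuous).comp cuspSubmodule.subtypeL) := by
  have hΓ := modular_le_range_toGL
  have hneg := neg_one_mem_modular
  have hd := isDiscreteSubgroup_modular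
  have hF := isHypFundamentalDomain_modular_fd
  haveI : IsFiniteMeasure μ𝒟 := isFiniteMeasure_restrict_fd
  have hkc : Continuous k := hL.continuous
  obtain ⟨Bk, hBk⟩ := hk.bounded
  have hBk0 : 0 ≤ Bk := (abs_nonneg _).trans (hBk 0)
  set T := modularKernelCLM hk hkc with hT
  set ι := (cuspSubmodule.subtypeL : cuspSubmodule →L[ℂ] Lp ℂ 2 μ𝒟) with hι
  set R := kernelRadius M with hR
  -- reduce to total boundedness of the image of the closed unit ball
  refine (isCompactOperator_iff_isCompact_closure_image_closedBall
    ((T.comp ι : cuspSubmodule →L[ℂ] Lp ℂ 2 μ𝒟) : cuspSubmodule →ₗ[ℂ] Lp ℂ 2 μ𝒟) one_pos).mpr ?_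
  rw [isCompact_iff_totallyBounded_isComplete]
  refine ⟨TotallyBounded.closure ?_, isClosed_closure.isComplete⟩
  rw [Metric.totallyBounded_iff]
  intro ε hε
  -- constants
  set Λ : ℝ := (measureUnivNNReal μ𝒟 : ℝ) ^ (2 : ℝ≥0∞).toReal⁻¹ with hΛ
  have hΛ0 : 0 ≤ Λ := by rw [hΛ]; positivity
  set β : ℝ := ε / (2 * (Λ + 1)) with hβ
  have hβ0 : 0 < β := by rw [hβ]; positivity
  set Ck := cuspConst L M with hCk
  have hCk0 : 0 ≤ Ck := cuspConst_nonneg L M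
  -- the height of truncation
  set Y : ℝ := max (Real.exp (R + 1)) (((2 * Ck + 1) / β) ^ 2) with hY
  have hYexp : Real.exp (R + 1) ≤ Y := le_max_left _ _
  have hY0 : 0 < Y := lt_of_lt_of_le (Real.exp_pos _) hYexp
  have hYβ : 1 / Real.sqrt Y ≤ β / (2 * Ck + 1) := by
    have h1 : (2 * Ck + 1) / β ≤ Real.sqrt Y := by
      rw [Real.le_sqrt (by positivity) hY0.le]
      exact le_max_right _ _
    rw [div_le_div_iff₀ (Real.sqrt_pos.mpr hY0) (by positivity), one_mul]
    rw [div_le_iff₀ hβ0] at h1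
    linarith
  -- the local constant on `𝒟_Y` and the scale `δ`
  set A : ℝ := Real.sqrt ((volume (Metric.closedBall UpperHalfPlane.I (R + 1))).toReal) *
    Real.sqrt (orbitBound (2 * (|Y| + 2) + (R + 1)) / 2) with hA
  have hA0 : 0 ≤ A := by rw [hA]; unfold orbitBound; positivity
  set δ : ℝ := min 1 (β / (4 * (oscConst L M * A) + 1)) with hδ
  have hδ0 : 0 < δ := lt_min one_pos (div_pos hβ0 (by linarith [mul_nonneg (oscConst_nonneg L M) hA0]))
  have hδ1 : δ ≤ 1 := min_le_left _ _
  have hδβ : 2 * (oscConst L M * A) * δ ≤ β / 2 := by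
    have h1 : δ ≤ β / (4 * (oscConst L M * A) + 1) := min_le_right _ _
    have h2 : 0 ≤ oscConst L M * A := mul_nonneg (oscConst_nonneg L M) hA0
    rw [le_div_iff₀ (by linarith)] at h1
    nlinarith
  -- finite `δ`-cover of the compact `𝒟_Y`
  obtain ⟨t, hts, htf, hcov⟩ := finite_cover_balls_of_compact (isCompact_fdTrunc Y) hδ0
  haveI : Fintype t := htf.fintype
  -- point evaluations at the finitely many centres
  set Ψ : cuspSubmodule → (t → ℂ) := fun g i => kernelOp Γℤ 𝒟 k (g : Lp ℂ 2 μ𝒟) (i : ℍ) with hΨ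
  set ball𝓒 : Set cuspSubmodule := Metric.closedBall 0 1 with hball
  -- uniform bound `|T_k g(z)| ≤ Bk A ‖g‖` for `z ∈ 𝒟_Y`
  have hptbound : ∀ (g : Lp ℂ 2 μ𝒟) (z : ℍ), z ∈ fdTrunc Y →
      ‖kernelOp Γℤ 𝒟 k g z‖ ≤ Bk * A * ‖g‖ := by
    intro g z hz
    rw [kernelOp_eq_invariantOperator hΓ hneg hd hF hk (Lp.memLp g) z]
    have hGl := locallyIntegrable_autExt hΓ hneg hd hF (Lp.memLp g)
    refine (norm_invariantOperator_le' hBk hM hGl z).trans ?_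
    have hmono : ∫ w in Metric.closedBall z R, ‖autExt Γℤ 𝒟 g w‖ ≤
        ∫ w in Metric.closedBall z (R + 1), ‖autExt Γℤ 𝒟 g w‖ :=
      setIntegral_mono_set ((hGl.integrableOn_isCompact (isCompact_closedBall _ _)).norm)
        (Eventually.of_forall fun w => norm_nonneg _)
        (Eventually.of_forall (Metric.closedBall_subset_closedBall (by linarith)))
    have hloc := integral_norm_autExt_closedBall_le M Y (Lp.memLp g) hz
    rw [← norm_eq_sqrt_lintegral g, ← hR, ← hA] at hloc
    rw [mul_assoc]
    exact mul_le_mul_of_nonneg_left (hmono.trans hloc) hBk0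
  -- the image of the unit ball under `Ψ` is bounded, hence totally bounded
  have hΨbdd : Ψ '' ball𝓒 ⊆ Metric.closedBall 0 (Bk * A) := by
    rintro _ ⟨g, hg, rfl⟩
    rw [Metric.mem_closedBall, dist_zero_right, pi_norm_le_iff_of_nonneg (by positivity)]
    intro i
    have hg1 : ‖(g : Lp ℂ 2 μ𝒟)‖ ≤ 1 := by
      rw [hball, Metric.mem_closedBall, dist_zero_right] at hg
      exact hg
    calc ‖Ψ g i‖ ≤ Bk * A * ‖(g : Lp ℂ 2 μ𝒟)‖ := hptbound g i (hts i.2)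
      _ ≤ Bk * A * 1 := by gcongr
      _ = Bk * A := mul_one _
  have hΨtb : TotallyBounded (Ψ '' ball𝓒) :=
    (isCompact_closedBall _ _).totallyBounded.subset hΨbdd
  -- a finite `β/2`-net of evaluation vectors inside the image
  obtain ⟨u, hu_sub, huf, hucov⟩ := hΨtb.exists_subset (Metric.dist_mem_uniformity (half_pos hβ0))
  -- pull the net back to cusp forms
  have hpre : ∀ y ∈ u, ∃ g ∈ ball𝓒, Ψ g = y := fun y hy => hu_sub hy
  choose! gsel hgsel_mem hgsel_eq using hpre
  refine ⟨(fun y => (T.comp ι) (gsel y)) '' u, huf.image _, ?_⟩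
  -- covering
  rintro _ ⟨g, hg, rfl⟩
  obtain ⟨y, hyu, hy⟩ : ∃ y ∈ u, dist (Ψ g) y < β / 2 := by
    have := hucov ⟨g, hg, rfl⟩
    simpa only [mem_iUnion, mem_setOf_eq, exists_prop] using this
  rw [mem_iUnion₂]
  refine ⟨(T.comp ι) (gsel y), mem_image_of_mem _ hyu, ?_⟩
  rw [Metric.mem_ball, dist_eq_norm]
  change ‖(T.comp ι) g - (T.comp ι) (gsel y)‖ < ε
  rw [← map_sub]
  -- the difference `h = g - gsel y ∈ 𝓒`, `‖h‖ ≤ 2`, with small evaluations at the centres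
  set h : cuspSubmodule := g - gsel y with hh
  have hg1 : ‖(g : Lp ℂ 2 μ𝒟)‖ ≤ 1 := by
    rw [hball, Metric.mem_closedBall, dist_zero_right] at hg; exact hg
  have hgy1 : ‖(gsel y : Lp ℂ 2 μ𝒟)‖ ≤ 1 := by
    have := hgsel_mem y hyu
    rw [hball, Metric.mem_closedBall, dist_zero_right] at this; exact this
  have hh2 : ‖(h : Lp ℂ 2 μ𝒟)‖ ≤ 2 := by
    rw [hh, Submodule.coe_sub]
    exact (norm_sub_le _ _).trans (by linarith)
  have heval : ∀ i : t, ‖kernelOp Γℤ 𝒟 k (h : Lp ℂ 2 μ𝒟) (i : ℍ)‖ < β / 2 := by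
    intro i
    rw [hh, Submodule.coe_sub, kernelOp_coe_sub hk hkc]
    have h1 : dist (Ψ g) (Ψ (gsel y)) < β / 2 := by rw [hgsel_eq y hyu]; exact hy
    have h2 := (dist_le_pi_dist (Ψ g) (Ψ (gsel y)) i).trans_lt h1
    rwa [dist_eq_norm] at h2
  -- cuspidality and the automorphic extension of `h`
  have hhcusp : cuspMean (autExt Γℤ 𝒟 ((h : Lp ℂ 2 μ𝒟) : ℍ → ℂ)) =ᵐ[volume] 0 :=
    (mem_cuspSubmodule_iff _).mp h.2
  have hhmem : MemLp ((h : Lp ℂ 2 μ𝒟) : ℍ → ℂ) 2 μ𝒟 := Lp.memLp _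
  have hHl := locallyIntegrable_autExt hΓ hneg hd hF hhmem
  -- the pointwise bound `‖T_k h(w)‖ ≤ β` on `𝒟`
  have hpw : ∀ w ∈ (𝒟 : Set ℍ), ‖kernelOp Γℤ 𝒟 k (h : Lp ℂ 2 μ𝒟) w‖ ≤ β := by
    intro w hw𝒟
    rcases le_or_gt w.im Y with hwY | hwY
    · -- on the compact part: compare with the nearest centre
      have hwC : w ∈ fdTrunc Y := ⟨hw𝒟, hwY⟩
      obtain ⟨i, hit, hwi⟩ : ∃ i ∈ t, w ∈ Metric.ball i δ := by
        have := hcov hwC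
        simpa only [mem_iUnion, exists_prop] using this
      have hdist : dist w i ≤ 1 := (le_of_lt (Metric.mem_ball.mp hwi)).trans hδ1
      have hosc := norm_invariantOperator_sub_le hk hL hM hHl hdist
      have hloc := integral_norm_autExt_closedBall_le M Y hhmem hwC
      rw [← norm_eq_sqrt_lintegral, ← hR, ← hA] at hloc
      have e1 := kernelOp_eq_invariantOperator hΓ hneg hd hF hk hhmem w
      have e2 := kernelOp_eq_invariantOperator hΓ hneg hd hF hk hhmem (i : ℍ)
      have hev := heval ⟨i, hit⟩
      calc ‖kernelOp Γℤ 𝒟 k (h : Lp ℂ 2 μ𝒟) w‖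
          ≤ ‖kernelOp Γℤ 𝒟 k (h : Lp ℂ 2 μ𝒟) w - kernelOp Γℤ 𝒟 k (h : Lp ℂ 2 μ𝒟) i‖ +
              ‖kernelOp Γℤ 𝒟 k (h : Lp ℂ 2 μ𝒟) i‖ := norm_le_norm_sub_add _ _
        _ ≤ oscConst L M * dist w i * (A * ‖(h : Lp ℂ 2 μ𝒟)‖) + β / 2 := by
            refine add_le_add ?_ hev.le
            rw [e1, e2]
            refine hosc.trans ?_
            exact mul_le_mul_of_nonneg_left hloc (mul_nonneg (oscConst_nonneg L M) dist_nonneg)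
        _ ≤ oscConst L M * δ * (A * 2) + β / 2 := by
            have hwi' : dist w i ≤ δ := le_of_lt (Metric.mem_ball.mp hwi)
            exact add_le_add (mul_le_mul (mul_le_mul_of_nonneg_left hwi' (oscConst_nonneg L M))
              (mul_le_mul_of_nonneg_left hh2 hA0) (mul_nonneg hA0 (norm_nonneg _))
              (mul_nonneg (oscConst_nonneg L M) hδ0.le)) le_rfl
        _ = 2 * (oscConst L M * A) * δ + β / 2 := by ring
        _ ≤ β / 2 + β / 2 := by linarith
        _ = β := by ring
    · -- high in the cusp
      have hwexp : Real.exp (R + 1) ≤ w.im := hYexp.trans hwY.le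
      have hc := norm_kernelOp_le_of_cuspidal hk hL hM hhmem hhcusp hwexp
      rw [← norm_eq_sqrt_lintegral, ← hCk, rpow_neg_one_half_eq_one_div_sqrt w.im_pos] at hc
      refine hc.trans ?_
      have h1 : 1 / Real.sqrt w.im ≤ 1 / Real.sqrt Y :=
        one_div_le_one_div_of_le (Real.sqrt_pos.mpr hY0) (Real.sqrt_le_sqrt hwY.le)
      calc Ck * (1 / Real.sqrt w.im) * ‖(h : Lp ℂ 2 μ𝒟)‖ ≤ Ck * (β / (2 * Ck + 1)) * 2 :=
            mul_le_mul (mul_le_mul_of_nonneg_left (h1.trans hYβ) hCk0) hh2 (norm_nonneg _)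
              (mul_nonneg hCk0 (by positivity))
        _ ≤ β := by
            rw [mul_div_assoc', div_mul_eq_mul_div, div_le_iff₀ (by linarith)]
            nlinarith
  -- integrate the pointwise bound
  have hae : ∀ᵐ w ∂μ𝒟, ‖(T (h : Lp ℂ 2 μ𝒟)) w‖ ≤ β := by
    have h1 := kernelCLM_coeFn hΓ hneg hd hF hk hkc (h : Lp ℂ 2 μ𝒟)
    have h2 : ∀ᵐ w ∂μ𝒟, w ∈ (𝒟 : Set ℍ) := ae_restrict_mem hF.measurableSet
    filter_upwards [h1, h2] with w hw1 hw2
    rw [hT, hw1]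
    exact hpw w hw2
  have hnorm := Lp.norm_le_of_ae_bound hβ0.le hae
  rw [← hΛ] at hnorm
  have e : (T.comp ι) h = T (h : Lp ℂ 2 μ𝒟) := rfl
  rw [e]
  calc ‖T (h : Lp ℂ 2 μ𝒟)‖ ≤ Λ * β := hnorm
    _ ≤ (Λ + 1) * β := by gcongr; linarith
    _ = ε / 2 := by rw [hβ]; field_simp
    _ < ε := half_lt_self hε

end Compact

/-! ## 8. The commuting family of compact self-adjoint operators on the Hilbert space `𝓒` -/

section CuspOperator

local notation "Γℤ" => (𝒮ℒ : Subgroup (GL (Fin 2) ℝ))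
set_option quotPrecheck false in
/-- The measure of `L²(𝒟)`: the hyperbolic measure restricted to `𝒟`. -/
local notation "μ𝒟" => MeasureTheory.Measure.restrict (volume : Measure ℍ) (ModularGroup.fd)

variable {k k' : ℝ → ℝ} {L : ℝ≥0} {M : ℝ}

/-- The cuspidal subspace, being closed in `L²(𝒟)`, is a Hilbert space. [cite: Iwaniec2002, §3.3, PDF p. 44] -/
instance completeSpace_cuspSubmodule : CompleteSpace cuspSubmodule :=
  isClosed_cuspSubmodule.completeSpace_coe

/-- **`T_k` as an operator on the Hilbert space `𝓒`** (the restriction of `T_k` to the invariant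
closed subspace of cusp forms, Iwaniec §4.2 Proposition & §4.3). [cite: Iwaniec2002, §4.2–§4.3, PDF pp. 49–52] -/
def cuspKernelCLM (hk : IsTestKernel k) (hkc : Continuous k) : cuspSubmodule →L[ℂ] cuspSubmodule :=
  ((modularKernelCLM hk hkc).comp cuspSubmodule.subtypeL).codRestrict cuspSubmodule
    (fun g => kernelCLM_mem_cuspSubmodule hk hkc g.2)

/-- Underlying vectors: `(T_k|_𝓒 g : L²(𝒟)) = T_k g`. [folklore] -/
theorem coe_cuspKernelCLM (hk : IsTestKernel k) (hkc : Continuous k) (g : cuspSubmodule) :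
    ((cuspKernelCLM hk hkc g : cuspSubmodule) : Lp ℂ 2 μ𝒟) = modularKernelCLM hk hkc (g : Lp ℂ 2 μ𝒟) :=
  rfl

/-- **`T_k|_𝓒` is compact** for every Lipschitz test kernel. [cite: Iwaniec2002, Prop. 4.5 & §4.3, PDF pp. 50–52] -/
theorem isCompactOperator_cuspKernelCLM (hk : IsTestKernel k) (hL : LipschitzWith L k)
    (hM : ∀ u, M ≤ u → k u = 0) : IsCompactOperator (cuspKernelCLM hk hL.continuous) :=
  (isCompactOperator_kernelCLM_comp_cuspSubtype hk hL hM).codRestrict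
    (fun g => kernelCLM_mem_cuspSubmodule hk hL.continuous g.2) isClosed_cuspSubmodule

/-- `T_k|_𝓒` is symmetric. [cite: Iwaniec2002, §4.1, PDF p. 48] -/
theorem cuspKernelCLM_isSymmetric (hk : IsTestKernel k) (hkc : Continuous k) :
    (cuspKernelCLM hk hkc : cuspSubmodule →ₗ[ℂ] cuspSubmodule).IsSymmetric := by
  intro f g
  rw [Submodule.coe_inner, Submodule.coe_inner]
  exact kernelCLM_isSymmetric modular_le_range_toGL neg_one_mem_modular isDiscreteSubgroup_modular
    isHypFundamentalDomain_modular_fd hk hkc (f : Lp ℂ 2 μ𝒟) (g : Lp ℂ 2 μ𝒟)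

/-- **`T_k|_𝓒` is self-adjoint.** [cite: Iwaniec2002, §4.1, PDF p. 48] -/
theorem isSelfAdjoint_cuspKernelCLM (hk : IsTestKernel k) (hkc : Continuous k) :
    IsSelfAdjoint (cuspKernelCLM hk hkc) :=
  (cuspKernelCLM_isSymmetric hk hkc).isSelfAdjoint

/-- **The operators `T_k|_𝓒` commute** (§1.8). [cite: Iwaniec2002, §1.8, PDF pp. 20–21] -/
theorem commute_cuspKernelCLM (hk : IsTestKernel k) (hkc : Continuous k) (hk' : IsTestKernel k')
    (hkc' : Continuous k') : Commute (cuspKernelCLM hk hkc) (cuspKernelCLM hk' hkc') := by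
  change cuspKernelCLM hk hkc * cuspKernelCLM hk' hkc' = cuspKernelCLM hk' hkc' * cuspKernelCLM hk hkc
  refine ContinuousLinearMap.ext fun g => Subtype.ext ?_
  exact DFunLike.congr_fun (kernelCLM_comp_comm modular_le_range_toGL neg_one_mem_modular
    isDiscreteSubgroup_modular isHypFundamentalDomain_modular_fd hk hkc hk' hkc') (g : Lp ℂ 2 μ𝒟)

end CuspOperator

/-! ## 9. Lipschitz test kernels exist: the tent kernel -/

section Tent

/-- The tent kernel of width `δ`: `k_δ(u) = max(0, 1 - |u|/δ)` — a non-negative Lipschitz test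
kernel supported in `u ≤ δ` with `k_δ(0) = 1` (a Lipschitz substitute for the characteristic
function of `[0, δ]` used in the proof of Proposition 7.2). [cite: Iwaniec2002, §7.2, PDF p. 73] -/
def tentKernel (δ : ℝ) (u : ℝ) : ℝ := max 0 (1 - |u| / δ)

variable {δ : ℝ}

/-- `k_δ ≥ 0`. [folklore] -/
theorem tentKernel_nonneg (δ u : ℝ) : 0 ≤ tentKernel δ u := le_max_left _ _

/-- `k_δ ≤ 1`. [folklore] -/
theorem tentKernel_le_one (hδ : 0 < δ) (u : ℝ) : tentKernel δ u ≤ 1 := by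
  unfold tentKernel
  refine max_le zero_le_one ?_
  have : 0 ≤ |u| / δ := div_nonneg (abs_nonneg u) hδ.le
  linarith

/-- `k_δ(0) = 1`. [folklore] -/
@[simp] theorem tentKernel_zero (δ : ℝ) : tentKernel δ 0 = 1 := by
  simp [tentKernel]

/-- `k_δ(u) = 0` for `u ≥ δ > 0`. [folklore] -/
theorem tentKernel_eq_zero (hδ : 0 < δ) {u : ℝ} (hu : δ ≤ u) : tentKernel δ u = 0 := by
  unfold tentKernel
  refine max_eq_left ?_
  rw [abs_of_nonneg (hδ.le.trans hu), sub_nonpos, le_div_iff₀ hδ, one_mul]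
  exact hu

/-- `k_δ` is `δ⁻¹`-Lipschitz. [folklore] -/
theorem lipschitzWith_tentKernel (hδ : 0 < δ) :
    LipschitzWith (Real.toNNReal δ⁻¹) (tentKernel δ) := by
  have h1 : LipschitzWith (Real.toNNReal δ⁻¹) fun u : ℝ => 1 - |u| / δ := by
    refine LipschitzWith.of_dist_le_mul fun u v => ?_
    rw [Real.dist_eq, Real.dist_eq, Real.coe_toNNReal _ (inv_nonneg.mpr hδ.le)]
    rw [show (1 - |u| / δ) - (1 - |v| / δ) = (|v| - |u|) / δ by ring, abs_div, abs_of_pos hδ,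
      div_eq_inv_mul]
    refine mul_le_mul_of_nonneg_left ?_ (inv_nonneg.mpr hδ.le)
    rw [abs_sub_comm]
    exact abs_abs_sub_abs_le_abs_sub u v
  have e : tentKernel δ = fun u => max 0 (1 - |u| / δ) := rfl
  rw [e]
  exact LipschitzWith.const_max h1 0

/-- `k_δ` is continuous. [folklore] -/
theorem continuous_tentKernel (hδ : 0 < δ) : Continuous (tentKernel δ) :=
  (lipschitzWith_tentKernel hδ).continuous

/-- `k_δ` is a test kernel (measurable, bounded, vanishing on `[δ, ∞)`). [folklore] -/
theorem isTestKernel_tentKernel (hδ : 0 < δ) : IsTestKernel (tentKernel δ) where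
  measurable := (continuous_tentKernel hδ).measurable
  bounded := ⟨1, fun u => by
    rw [abs_of_nonneg (tentKernel_nonneg δ u)]; exact tentKernel_le_one hδ u⟩
  eventually_zero := ⟨δ, hδ.le, fun u hu => tentKernel_eq_zero hδ hu⟩

/-- Non-vacuity of the compactness theorem: the tent kernels give compact self-adjoint operators
`T_{k_δ}|_𝓒` on the cusp forms of `SL₂(ℤ)`. [cite: Iwaniec2002, §4.3, PDF pp. 51–52] -/
theorem isCompactOperator_cuspKernelCLM_tentKernel (hδ : 0 < δ) :
    IsCompactOperator (cuspKernelCLM (isTestKernel_tentKernel hδ) (continuous_tentKernel hδ)) :=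
  isCompactOperator_cuspKernelCLM (isTestKernel_tentKernel hδ) (lipschitzWith_tentKernel hδ)
    (fun _ hu => tentKernel_eq_zero hδ hu)

end Tent

end Literature.NumberTheory.Automorphic
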